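import Literature.AnabelianGeometry.EtaleTheta.ArithThetaTowerThetaRest
import HarnessLib

/-!
# [IUTchI] Ex. 3.2 (v) at the ARITHMETIC theta tower: the UNIT PART of `𝒞^Θ_v ⊆ ℱ÷_v` —
# `𝒪^▷_{𝒞^Θ_v}(A^Θ) = 𝒪^×(T_{A^Θ}) · Θ̲_v^ℕ|_{T_{A^Θ}}` read in the rational function monoid `B(Ÿ_T × A)`
# (GAP A item GA-06, FIELDS half of D6, file 2/3: naturality of the constants and the unit map `q̲_v ↦ Θ̲_v`)

S. Mochizuki, *Inter-universal Teichmüller Theory I* [Mochizuki2012], Ex. 3.2 (v) p.72: «for `A^Θ ∈ Ob(𝒟^Θ_v)` the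
assignment `A^Θ ↦ 𝒪^×(T_{A^Θ}) · (Θ̲_v^ℕ|_{T_{A^Θ}}) ⊆ 𝒪^×(T^÷_{A^Θ})` determines a monoid `𝒪^▷_{𝒞^Θ_v}(−)` on `𝒟^Θ_v` …
natural isomorphisms `𝒪^▷_{𝒞⊢_v}(−) ⥲ 𝒪^▷_{𝒞^Θ_v}(−)` … compatible with the assignment `q̲_v|_{T_A} ↦ Θ̲_v|_{T_{A^Θ}}` and the
natural isomorphism [induced by `A^Θ = Ÿ_v × A → A`] `𝒪^×(T_A) ⥲ 𝒪^×(T_{A^Θ})`» [claim: Mochizuki2012, status: disputed]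
(D-0012 claim key; DEFINITIONS + proved naturality over OUR typed objects; nothing of the series asserted); [MochizukiEtTh2009]
Def. 3.6 (ii) p.77 (the rational function monoid `B`); [MochizukiFrdII2008] Ex. 1.1 (ii) p.8 (`B := B₀|_D ×_{Φ₀^gp} Φ^gp`
of the `p_v`-adic Frobenioid `𝒞^Θ_v` = the tree's `BadLocalGroupDatum.thetaDatum`).  Ruled shape: GAP-A-SIGNATURES v1 §5,
RULINGS #341 (B).  WHAT IS HERE, over `(hC : CarrierSpec d T C)` and `(hq : ¬ IsUnit qroot)`:
* `dThetaObj X = Ÿ_T × A` under `A^Θ ∈ 𝒟^Θ_v`, `dThetaHom`, `counitLeft`/`dThetaToIncl X : Ÿ_T × A → A|_{𝒟_v}` (counit of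
  `prodEquiv : 𝒟⊢_v ≌ 𝒟^Θ_v`, then `pr₂`), `projDTheta X : aug(Ÿ_T × A) → A` (adjunct along `T.proj ⊣ T.incl`),
  `thetaFieldHom X : Ω^A →+* Ω^{aug(Ÿ_T × A)}` / `thetaFieldUnits` — all NATURAL in `A^Θ`;
* NATURALITY along `𝒟_v̲` of file 1's producers: `CarrierSpec.base_map_comp_baseIso`, `pull_ofLattice`, `trB_natural`,
  **`constRatFn_natural`** (the GENUINE constants via `T.proj` form a morphism of monoids on `𝒟_v̲`: `κ`, `ι`, `div` natural);
* `thetaRatFnAt hC X = Θ̲|_{Ÿ_T × A} ∈ B(Ÿ_T × A)` (natural), `isUnit_ratFn` (`B` group-like), `qUnitsAt` (`q̲_v`, a constant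
  section), `rhoAt X = Θ̲|_{Ÿ_T × A} · q̲_v⁻¹` (natural), `logqAt`/`rhoPow`/`rhoPowGp` (`n·log q̲_v ↦ ρ^n`; `Φ_{𝒞^Θ_v}` is free on
  `log q̲_v`), and **`unitPart hC hq X : B_{𝒞^Θ_v}(A^Θ) →* B(Ÿ_T × A)^×`**, `x ↦ const(x) · ρ^{n(x)}`: a unit `u` goes to the
  CONSTANT `u`, `q̲_v` goes to `Θ̲|_{Ÿ_T × A}` — print's «`𝒪^×(T_A) ⥲ 𝒪^×(T_{A^Θ})`, `q̲_v|_{T_A} ↦ Θ̲_v|_{T_{A^Θ}}`»; a monoid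
  homomorphism NATURAL in `A^Θ` (`unitPart_natural`).  The functor `cThetaToBirat` is file 3/3.
carrier: genuine-by-[EtTh]-recipe on the T-lattice (Ÿ_T, Ÿ_T × V, X̲̲_v̲ × V) + constants everywhere; off-lattice Φ via
`rebase`/pullback; [EtTh] Def 3.3 Φ at general U and print's Ÿ̈/μ_N Kummer levels = FOUNDATIONS 13/14, not claimed (#322
(c3′); this file defines no carrier).  HONEST FRAMING: DATA + proved naturality over a `Prop`-valued spec at OUR typed
objects; TYPED ≠ INHABITED (the term is GA-12's) ≠ proved-in-print; an UNDISPUTED construction around [IUTchIII] Cor. 3.12,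
which stays OPEN by charter (D-0045) — no side taken; nothing here asserts abc proved or refuted; count-neutral.  No
instance, no notation, no `sorry`.
-/

noncomputable section

namespace Literature.AnabelianGeometry.EtaleTheta

namespace ArithThetaTower

open CategoryTheory Opposite Function Literature.AlgebraicGeometry.Frobenioids Literature.AnabelianGeometry.SemiGraphs
  Literature.IUT.HodgeTheaters Literature.AlgebraicGeometry.Frobenioids.PadicFrd

variable {p : ℕ} [Fact p.Prime] {d : GaloisValDatum.{0} p} {P : Type} [Group P] [TopologicalSpace P]
  {T : BadLocalGroupDatum d.Gal P}

variable (T) in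
/-- `Ÿ_T × A ∈ 𝒟_v̲`, the object under `A^Θ ∈ 𝒟^Θ_v ⊆ (𝒟_v)_{Ÿ_v}`. ([IUTchI] Ex 3.2 (v) p.72) [claim: Mochizuki2012, status: disputed] -/
abbrev dThetaObj (X : T.DTheta) : T.Dv := (T.dThetaIncl.obj X).left

variable (T) in
/-- `Ÿ_T × A → Ÿ_T × A'` under a morphism of `𝒟^Θ_v`. ([IUTchI] Ex 3.2 (v) p.72) [claim: Mochizuki2012, status: disputed] -/
abbrev dThetaHom {X Y : T.DTheta} (f : X ⟶ Y) : dThetaObj T X ⟶ dThetaObj T Y := (T.dThetaIncl.map f).left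

/-- `dThetaHom` respects identities. ([IUTchI] Ex 3.2 (v) p.72) [claim: Mochizuki2012, status: disputed] -/
theorem dThetaHom_id (X : T.DTheta) : dThetaHom T (𝟙 X) = 𝟙 (dThetaObj T X) := by
  change (T.dThetaIncl.map (𝟙 X)).left = _
  rw [CategoryTheory.Functor.map_id]
  rfl

/-- `dThetaHom` respects composition. ([IUTchI] Ex 3.2 (v) p.72) [claim: Mochizuki2012, status: disputed] -/
theorem dThetaHom_comp {X Y Z : T.DTheta} (f : X ⟶ Y) (g : Y ⟶ Z) :
    dThetaHom T (f ≫ g) = dThetaHom T f ≫ dThetaHom T g := by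
  change (T.dThetaIncl.map (f ≫ g)).left = _
  rw [CategoryTheory.Functor.map_comp, Over.comp_left]

/-- `dThetaHom f` lies over `Ÿ_T`. ([IUTchI] Ex 3.2 (v) p.72) [claim: Mochizuki2012, status: disputed] -/
theorem dThetaHom_w {X Y : T.DTheta} (f : X ⟶ Y) :
    dThetaHom T f ≫ (T.dThetaIncl.obj Y).hom = (T.dThetaIncl.obj X).hom :=
  Over.w (T.dThetaIncl.map f)

variable (T) in
/-- `Ÿ_T × A → Ÿ_T × A₀`, `A₀ := prodEquiv⁻¹ A^Θ`: the counit of `𝒟⊢_v ≌ 𝒟^Θ_v` in `𝒟_v̲`. ([IUTchI] Ex 3.2 (v) p.72) [claim: Mochizuki2012, status: disputed] -/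
def counitLeft (X : T.DTheta) : dThetaObj T X ⟶ T.prodObj (T.prodEquiv.inverse.obj X) :=
  (T.dThetaIncl.map (T.prodEquiv.counitInv.app X)).left

/-- `counitLeft` is natural in `A^Θ`. ([IUTchI] Ex 3.2 (v) p.72) [claim: Mochizuki2012, status: disputed] -/
theorem dThetaHom_comp_counitLeft {X Y : T.DTheta} (f : X ⟶ Y) :
    dThetaHom T f ≫ counitLeft T Y = counitLeft T X ≫ T.prodMap (T.prodEquiv.inverse.map f) := by
  have hn : f ≫ T.prodEquiv.counitInv.app Y =
      T.prodEquiv.counitInv.app X ≫ T.prodEquiv.functor.map (T.prodEquiv.inverse.map f) :=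
    T.prodEquiv.counitInv.naturality f
  have h := congrArg (fun g => (T.dThetaIncl.map g).left) hn
  simp only [CategoryTheory.Functor.map_comp, Over.comp_left] at h
  exact h

variable (T) in
/-- `Ÿ_T × A → A|_{𝒟_v}`: the counit followed by `pr₂`. ([IUTchI] Ex 3.2 (v) p.72) [claim: Mochizuki2012, status: disputed] -/
def dThetaToIncl (X : T.DTheta) : dThetaObj T X ⟶ T.incl.obj (T.prodEquiv.inverse.obj X) :=
  counitLeft T X ≫ T.prodSnd (T.prodEquiv.inverse.obj X)

/-- `dThetaToIncl` is natural in `A^Θ`. ([IUTchI] Ex 3.2 (v) p.72) [claim: Mochizuki2012, status: disputed] -/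
theorem dThetaToIncl_natural {X Y : T.DTheta} (f : X ⟶ Y) :
    dThetaToIncl T X ≫ T.incl.map (T.prodEquiv.inverse.map f) = dThetaHom T f ≫ dThetaToIncl T Y := by
  rw [dThetaToIncl, dThetaToIncl, Category.assoc, ← T.prodMap_snd, ← Category.assoc, ← Category.assoc,
    dThetaHom_comp_counitLeft]

variable (T) in
/-- `aug(Ÿ_T × A) → A` in `𝒟⊢_v`: the adjunct of `dThetaToIncl` along `T.proj ⊣ T.incl` (`aug(Π_Ÿ ∩ aug⁻¹ V) = V`).
([IUTchI] Ex 3.2 (v) p.72) [claim: Mochizuki2012, status: disputed] -/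
def projDTheta (X : T.DTheta) : T.proj.obj (dThetaObj T X) ⟶ T.prodEquiv.inverse.obj X :=
  (T.adj.homEquiv _ _).symm (dThetaToIncl T X)

/-- `projDTheta` is natural in `A^Θ`. ([IUTchI] Ex 3.2 (v) p.72) [claim: Mochizuki2012, status: disputed] -/
theorem projDTheta_natural {X Y : T.DTheta} (f : X ⟶ Y) :
    projDTheta T X ≫ T.prodEquiv.inverse.map f = T.proj.map (dThetaHom T f) ≫ projDTheta T Y := by
  rw [projDTheta, projDTheta, ← Adjunction.homEquiv_naturality_right_symm, dThetaToIncl_natural,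
    Adjunction.homEquiv_naturality_left_symm]

variable (d T) in
/-- **The base field of `A^Θ` read at `aug(Ÿ_T × A)`**: `Ω^{A} →+* Ω^{aug(Ÿ_T × A)}` along `projDTheta` («the natural
isomorphism [induced by `A^Θ = Ÿ_v × A → A`]»). ([IUTchI] Ex 3.2 (v) p.72) [claim: Mochizuki2012, status: disputed] -/
def thetaFieldHom (X : T.DTheta) : ((T.thetaBase d).obj X).K →+* (d.fieldFunctor.obj (T.proj.obj (dThetaObj T X))).K :=
  (d.fieldFunctor.map (projDTheta T X)).alg

/-- `thetaFieldHom` is natural in `A^Θ` (as ring homomorphisms). ([IUTchI] Ex 3.2 (v) p.72) [claim: Mochizuki2012, status: disputed] -/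
theorem thetaFieldHom_comp {X Y : T.DTheta} (f : X ⟶ Y) :
    (thetaFieldHom d T X).comp ((T.thetaBase d).map f).alg =
      (d.fieldFunctor.map (T.proj.map (dThetaHom T f))).alg.comp (thetaFieldHom d T Y) := by
  change (d.fieldFunctor.map (projDTheta T X) ≫ d.fieldFunctor.map (T.prodEquiv.inverse.map f)).alg =
    (d.fieldFunctor.map (T.proj.map (dThetaHom T f)) ≫ d.fieldFunctor.map (projDTheta T Y)).alg
  rw [← CategoryTheory.Functor.map_comp, ← CategoryTheory.Functor.map_comp, projDTheta_natural]

variable (d T) in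
/-- `thetaFieldHom` on units: `(Ω^{A})^× → (Ω^{aug(Ÿ_T × A)})^×`. ([IUTchI] Ex 3.2 (v) p.72) [claim: Mochizuki2012, status: disputed] -/
def thetaFieldUnits (X : T.DTheta) :
    (((T.thetaBase d).obj X).K)ˣ →* ((d.fieldFunctor.obj (T.proj.obj (dThetaObj T X))).K)ˣ :=
  Units.map (thetaFieldHom d T X : ((T.thetaBase d).obj X).K →* (d.fieldFunctor.obj (T.proj.obj (dThetaObj T X))).K)

/-- `thetaFieldUnits` is natural in `A^Θ`. ([IUTchI] Ex 3.2 (v) p.72) [claim: Mochizuki2012, status: disputed] -/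
theorem thetaFieldUnits_natural {X Y : T.DTheta} (f : X ⟶ Y) (v : (((T.thetaBase d).obj Y).K)ˣ) :
    thetaFieldUnits d T X
        (Units.map (((T.thetaBase d).map f).alg : ((T.thetaBase d).obj Y).K →* ((T.thetaBase d).obj X).K) v) =
      Units.map ((d.fieldFunctor.map (T.proj.map (dThetaHom T f))).alg :
          (d.fieldFunctor.obj (T.proj.obj (dThetaObj T Y))).K →* (d.fieldFunctor.obj (T.proj.obj (dThetaObj T X))).K)
        (thetaFieldUnits d T Y v) :=
  Units.ext (DFunLike.congr_fun (thetaFieldHom_comp f) (v : ((T.thetaBase d).obj Y).K))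

variable {T' : RealifiedDivisorMonoids (D₀ := T.Dv) treeMonoidVocabWeak.{0}} {VD : FrdICatStub.{0, 0, 0} T.Dv}
  {C : TemperedFrobenioid T' T.Dv VD}

namespace CarrierSpec

/-- `C.base = 𝟭` as a NATURAL family of isomorphisms `Y_A = A`. [cite: MochizukiEtTh2009, Def 3.6 p.77] -/
theorem base_map_comp_baseIso (hC : CarrierSpec d T C) {A B : T.Dv} (g : A ⟶ B) :
    C.base.map g ≫ (hC.baseIso B).hom = (hC.baseIso A).hom ≫ g := by
  simp [baseIso, Functor.congr_hom hC.base_eq g]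

/-- The same, on opposites. [cite: MochizukiEtTh2009, Def 3.6 p.77] -/
theorem baseIso_op_comp (hC : CarrierSpec d T C) {A B : T.Dv} (g : A ⟶ B) :
    (hC.baseIso B).hom.op ≫ (C.base.map g).op = g.op ≫ (hC.baseIso A).hom.op := by
  rw [← op_comp, ← op_comp, hC.base_map_comp_baseIso g]

/-- **The lattice read in `Φ` is natural**: pulling back `ofLattice B y` along `g : A → B` is `ofLattice A` of the lattice
pull-back. [cite: MochizukiEtTh2009, Def 3.6 p.77] -/
theorem pull_ofLattice (hC : CarrierSpec d T C) {A B : T.Dv} (g : A ⟶ B) (y : T'.Φ₀.obj (op B)) :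
    C.Φ.pull g.op (hC.ofLattice B y) = hC.ofLattice A ((T'.Φ₀.map g.op).hom y) := by
  apply Subtype.ext
  change (T'.ΦR.map (C.base.map g).op).hom ((hC.ofLattice B y : C.Φ.carrier (op B)) : T'.ΦR.obj (C.baseOp (op B))) =
    ((hC.ofLattice A ((T'.Φ₀.map g.op).hom y) : C.Φ.carrier (op A)) : T'.ΦR.obj (C.baseOp (op A)))
  rw [coe_ofLattice, coe_ofLattice, T'.toR_natural]
  have h1 := congrArg (fun φ => CommMonCat.Hom.hom φ (T'.toR (op B) y))
    (T'.ΦR.map_comp (hC.baseIso B).hom.op (C.base.map g).op)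
  have h2 := congrArg (fun φ => CommMonCat.Hom.hom φ (T'.toR (op B) y)) (T'.ΦR.map_comp g.op (hC.baseIso A).hom.op)
  simp only [CommMonCat.hom_comp, MonoidHom.comp_apply] at h1 h2
  rw [← h1, ← h2, hC.baseIso_op_comp g]

/-- Transport `trB` is natural: `trB A ∘ B₀^Λ(g) = B₀^Λ(Y_g) ∘ trB B`. [cite: MochizukiEtTh2009, Def 3.6 p.77] -/
theorem trB_natural (hC : CarrierSpec d T C) {A B : T.Dv} (g : A ⟶ B) (b : T'.BΛ.obj (op B)) :
    hC.trB A ((T'.BΛ.map g.op).hom b) = (T'.BΛ.map (C.base.map g).op).hom (hC.trB B b) := by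
  change (T'.BΛ.map (hC.baseIso A).hom.op).hom ((T'.BΛ.map g.op).hom b) =
    (T'.BΛ.map (C.base.map g).op).hom ((T'.BΛ.map (hC.baseIso B).hom.op).hom b)
  have h1 := congrArg (fun φ => CommMonCat.Hom.hom φ b) (T'.BΛ.map_comp g.op (hC.baseIso A).hom.op)
  have h2 := congrArg (fun φ => CommMonCat.Hom.hom φ b) (T'.BΛ.map_comp (hC.baseIso B).hom.op (C.base.map g).op)
  simp only [CommMonCat.hom_comp, MonoidHom.comp_apply] at h1 h2
  rw [← h1, ← h2, hC.baseIso_op_comp g]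

end CarrierSpec

/-- Groupification homomorphisms out of `M^gp` are determined on `M` (universal property of `M → M^gp`). [folklore] -/
private theorem gp_hom_ext_of' {M N : Type} [CommMonoid M] [CommGroup N]
    {f₁ f₂ : Algebra.GrothendieckGroup M →* N}
    (h : ∀ m : M, f₁ (Algebra.GrothendieckGroup.of m) = f₂ (Algebra.GrothendieckGroup.of m)) :
    f₁ = f₂ := by
  apply Algebra.GrothendieckGroup.lift.symm.injective
  rw [Algebra.GrothendieckGroup.lift_symm_apply, Algebra.GrothendieckGroup.lift_symm_apply]
  exact MonoidHom.ext h

/-- The universal map `M^gp → G` extends the given `M → G`. [folklore] -/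
private theorem lift_of' {M N : Type} [CommMonoid M] [CommGroup N] (f : M →* N) (m : M) :
    Algebra.GrothendieckGroup.lift f (Algebra.GrothendieckGroup.of m) = f m := by
  have h := Algebra.GrothendieckGroup.lift.symm_apply_apply f
  rw [Algebra.GrothendieckGroup.lift_symm_apply] at h
  exact DFunLike.congr_fun h m
set_option maxHeartbeats 400000 in -- buildfix (bf3-g31): 160k/180k FAIL, 200k PASS at accept time; line-neutral budget line
/-- **The genuine constants form a morphism of monoids on `𝒟_v̲`**: for `g : A → B` and a unit `v` of `Ω^{aug B}`,
`constRatFn A (v|_{Ω^{aug A}}) = B(g)(constRatFn B v)` — naturality of `κ` (a natural transformation), of `ι`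
(`consts` law 4) and of the divisor map `K^× → ord(𝒪^▷)^gp` (`PadicFrd.divUnits_map`). [cite: MochizukiEtTh2009, Def 3.6 p.77] -/
theorem constRatFn_natural (hC : CarrierSpec d T C) {A B : T.Dv} (g : A ⟶ B)
    (v : ((d.fieldFunctor.obj (T.proj.obj B)).K)ˣ) :
    constRatFn hC A (Units.map ((d.fieldFunctor.map (T.proj.map g)).alg :
        (d.fieldFunctor.obj (T.proj.obj B)).K →* (d.fieldFunctor.obj (T.proj.obj A)).K) v) =
      (C.ratFnFunctor.map g.op).hom (constRatFn hC B v) := by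
  refine Subtype.ext (Prod.ext ?_ ?_)
  · change hC.trB A ((hC.constEmb.app (op A)).hom (((PadicFrd.bZeroOn (T.proj ⋙ d.fieldFunctor)).map g.op).hom v)) =
      (T'.BΛ.map (C.base.map g).op).hom (hC.trB B ((hC.constEmb.app (op B)).hom v))
    have hκ := congrArg (fun φ => CommMonCat.Hom.hom φ v) (hC.constEmb.naturality g.op)
    simp only [CommMonCat.hom_comp, MonoidHom.comp_apply] at hκ
    rw [hκ]
    exact hC.trB_natural g _
  · have hdu : PadicFrd.divUnits (d.fieldFunctor.obj (T.proj.obj A)).K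
        (Units.map ((d.fieldFunctor.map (T.proj.map g)).alg :
          (d.fieldFunctor.obj (T.proj.obj B)).K →* (d.fieldFunctor.obj (T.proj.obj A)).K) v) =
        gpMap (PadicFrd.ordIntMapOfHom _ (d.fieldFunctor.map (T.proj.map g)).isValHom)
          (PadicFrd.divUnits (d.fieldFunctor.obj (T.proj.obj B)).K v) :=
      PadicFrd.divUnits_map _ (d.fieldFunctor.map (T.proj.map g)).isValHom v
    change gpMap (hC.ofLattice A) (gpMap (hC.constDivIncl (op A))
        (PadicFrd.divUnits (d.fieldFunctor.obj (T.proj.obj A)).K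
          (Units.map ((d.fieldFunctor.map (T.proj.map g)).alg :
            (d.fieldFunctor.obj (T.proj.obj B)).K →* (d.fieldFunctor.obj (T.proj.obj A)).K) v))) =
      gpMap (C.Φ.pull g.op) (gpMap (hC.ofLattice B) (gpMap (hC.constDivIncl (op B))
        (PadicFrd.divUnits (d.fieldFunctor.obj (T.proj.obj B)).K v)))
    rw [hdu]
    have key : (gpMap (hC.ofLattice A)).comp ((gpMap (hC.constDivIncl (op A))).comp
        (gpMap (PadicFrd.ordIntMapOfHom _ (d.fieldFunctor.map (T.proj.map g)).isValHom))) =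
        (gpMap (C.Φ.pull g.op)).comp ((gpMap (hC.ofLattice B)).comp (gpMap (hC.constDivIncl (op B)))) :=
      gp_hom_ext_of' fun x => by
        change gpMap (hC.ofLattice A) (gpMap (hC.constDivIncl (op A)) (gpMap _ (Algebra.GrothendieckGroup.of x))) =
          gpMap (C.Φ.pull g.op) (gpMap (hC.ofLattice B) (gpMap _ (Algebra.GrothendieckGroup.of x)))
        rw [gpMap_of, gpMap_of, gpMap_of, gpMap_of, gpMap_of, gpMap_of, hC.pull_ofLattice,
          hC.consts_spec.2.2.2.1 g.op x]
        rfl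
    exact DFunLike.congr_fun key _

/-- Every rational function is a unit (`B` group-like: `objectwise_isGroupLike_weak`). [cite: MochizukiEtTh2009, Def 3.6 p.76] -/
theorem isUnit_ratFn (C : TemperedFrobenioid T' T.Dv VD) (A : T.Dv) (x : C.ratFnFunctor.obj (op A)) : IsUnit x :=
  Associates.mk_eq_one.mp (@Subsingleton.elim _ (C.objectwise_isGroupLike_weak A).subsingleton_associates _ _)

/-- **`Θ̲|_{Ÿ_T × A} ∈ B(Ÿ_T × A)`**: the Θ̈-fraction pulled back along `pr₁ : Ÿ_T × A → Ÿ_T` («`Θ̲_v|_{T_{A^Θ}}`»).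
([IUTchI] Ex 3.2 (v) p.72) [claim: Mochizuki2012, status: disputed] -/
def thetaRatFnAt (hC : CarrierSpec d T C) (X : T.DTheta) : (C.ratFnFunctor.obj (op (dThetaObj T X)) : Type) :=
  (C.ratFnFunctor.map (T.dThetaIncl.obj X).hom.op).hom (thetaRatFn hC)

/-- `Θ̲|_{Ÿ_T × A}` is natural in `A^Θ` (`Ÿ_T × f` lies over `Ÿ_T`). ([IUTchI] Ex 3.2 (v) p.72) [claim: Mochizuki2012, status: disputed] -/
theorem thetaRatFnAt_natural (hC : CarrierSpec d T C) {X Y : T.DTheta} (f : X ⟶ Y) :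
    (C.ratFnFunctor.map (dThetaHom T f).op).hom (thetaRatFnAt hC Y) = thetaRatFnAt hC X := by
  rw [thetaRatFnAt, thetaRatFnAt, ← MonoidHom.comp_apply, ← CommMonCat.hom_comp, ← Functor.map_comp, ← op_comp,
    dThetaHom_w]

variable (d T) in
/-- **`q̲_v` as a unit of `Ω^{aug(Ÿ_T × A)}`** (the constant section «image of `q̲_v`» of `𝒞^Θ_v`'s datum through
`thetaFieldUnits`). ([IUTchI] Ex 3.2 (iv) p.71) [claim: Mochizuki2012, status: disputed] -/
def qUnitsAt (qroot : intNonzero d.k) (X : T.DTheta) : ((d.fieldFunctor.obj (T.proj.obj (dThetaObj T X))).K)ˣ :=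
  thetaFieldUnits d T X (PadicFrd.intNonzeroToUnits _ ((d.relEmb.restrict T.prodEquiv.inverse).img qroot X))

/-- `q̲_v` is a constant section: natural in `A^Θ`. ([IUTchI] Ex 3.2 (iv) p.71) [claim: Mochizuki2012, status: disputed] -/
theorem qUnitsAt_natural {qroot : intNonzero d.k} (hq : ¬ IsUnit qroot) {X Y : T.DTheta} (f : X ⟶ Y) :
    Units.map ((d.fieldFunctor.map (T.proj.map (dThetaHom T f))).alg :
          (d.fieldFunctor.obj (T.proj.obj (dThetaObj T Y))).K →* (d.fieldFunctor.obj (T.proj.obj (dThetaObj T X))).K)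
        (qUnitsAt d T qroot Y) =
      qUnitsAt d T qroot X := by
  rw [qUnitsAt, qUnitsAt, ← thetaFieldUnits_natural,
    ((d.relEmb.restrict T.prodEquiv.inverse).isConstantSection hq).units_map_eq (T.thetaBase d) f]

/-- **`ρ := Θ̲|_{Ÿ_T × A} · q̲_v⁻¹ ∈ B(Ÿ_T × A)^×`** — the unit by which `q̲_v ↦ Θ̲_v` twists the constants.
([IUTchI] Ex 3.2 (v) p.72) [claim: Mochizuki2012, status: disputed] -/
def rhoAt (hC : CarrierSpec d T C) (qroot : intNonzero d.k) (X : T.DTheta) :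
    (C.ratFnFunctor.obj (op (dThetaObj T X)) : Type)ˣ :=
  (isUnit_ratFn C (dThetaObj T X) (thetaRatFnAt hC X)).unit *
    ((constRatFn hC (dThetaObj T X)).toHomUnits (qUnitsAt d T qroot X))⁻¹

/-- `ρ` is natural in `A^Θ`. ([IUTchI] Ex 3.2 (v) p.72) [claim: Mochizuki2012, status: disputed] -/
theorem rhoAt_natural (hC : CarrierSpec d T C) {qroot : intNonzero d.k} (hq : ¬ IsUnit qroot) {X Y : T.DTheta} (f : X ⟶ Y) :
    Units.map (C.ratFnFunctor.map (dThetaHom T f).op).hom (rhoAt hC qroot Y) = rhoAt hC qroot X := by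
  rw [rhoAt, rhoAt, map_mul, map_inv]
  congr 1
  · exact Units.ext (thetaRatFnAt_natural hC f)
  · congr 1
    exact Units.ext ((constRatFn_natural hC (dThetaHom T f) (qUnitsAt d T qroot Y)).symm.trans
      (congrArg _ (qUnitsAt_natural hq f)))

section UnitPart

variable {qroot : intNonzero d.k} (hq : ¬ IsUnit qroot)

variable (d T) in
/-- `log q̲_v ∈ Φ_{𝒞^Θ_v}(A^Θ) = ℕ·log q̲_v`, the generator (abc-iut-L1-t4's `BadLocalKit.logq` at `𝒞^Θ_v`'s datum).
([IUTchI] Ex 3.2 (v) p.72) [claim: Mochizuki2012, status: disputed] -/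
abbrev logqAt (X : T.DTheta) : ((T.thetaDatum d hq).Φ.obj (op X) : Type) :=
  PadicFrd.BadLocalKit.logq (d.relEmb.restrict T.prodEquiv.inverse) (T.thetaBase_isPadicLocal d) (T.isConnected_DTheta d)
    (T.isTotallyEpimorphic_DTheta d) hq (op X)

/-- Every element of `Φ_{𝒞^Θ_v}(A^Θ)` is a power of `log q̲_v`. ([IUTchI] Ex 3.2 (v) p.72) [claim: Mochizuki2012, status: disputed] -/
theorem exists_eq_logqAt_pow (X : T.DTheta) (z : ((T.thetaDatum d hq).Φ.obj (op X) : Type)) :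
    ∃ n : ℕ, z = logqAt d T hq X ^ n :=
  (PadicFrd.BadLocalKit.logq_generates _ _ _ _ hq (op X) z).exists

/-- `log q̲_v` is a constant section: `Φ_{𝒞^Θ_v}(f)(log q̲_v) = log q̲_v`. ([IUTchI] Ex 3.2 (v) p.72) [claim: Mochizuki2012, status: disputed] -/
theorem map_logqAt {X Y : T.DTheta} (f : X ⟶ Y) :
    ((T.thetaDatum d hq).Φ.map f.op).hom (logqAt d T hq Y) = logqAt d T hq X :=
  Subtype.ext (PadicFrd.Monogenic.phi0Map_gen (T.thetaBase d)
    ((d.relEmb.restrict T.prodEquiv.inverse).isConstantSection hq) f.op)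

include hq in
variable (d T) in
/-- The powers of `log q̲_v` in `Φ₀(A^Θ)` are distinct (`Monogenic.gen_pow_injective`). ([IUTchI] Ex 3.2 (v) p.72) [claim: Mochizuki2012, status: disputed] -/
theorem logq_pow_injective (X : T.DTheta) :
    Injective fun n : ℕ => PadicFrd.Monogenic.gen (T.thetaBase d) ((d.relEmb.restrict T.prodEquiv.inverse).img qroot) X ^ n :=
  PadicFrd.Monogenic.gen_pow_injective (T.thetaBase d) ((d.relEmb.restrict T.prodEquiv.inverse).isConstantSection hq)
    (T.thetaBase_isPadicLocal d X)
open Classical in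
variable (d T) in
/-- `(ℕ·log q̲_v)(A^Θ) → B(Ÿ_T × A)^×`, `n·log q̲_v ↦ ρ^n` (`Φ_{𝒞^Θ_v}(A^Θ)` is free on `log q̲_v`). ([IUTchI] Ex 3.2 (v) p.72) [claim: Mochizuki2012, status: disputed] -/
def rhoPow (hC : CarrierSpec d T C) (X : T.DTheta) :
    ((T.thetaDatum d hq).Φ.obj (op X) : Type) →* (C.ratFnFunctor.obj (op (dThetaObj T X)) : Type)ˣ :=
  (powersHom _ (rhoAt hC qroot X)).comp (Submonoid.powLogEquiv (logq_pow_injective d T hq X)).symm.toMonoidHom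

/-- `rhoPow` on the `n`-th power of the generator is `ρ^n`. ([IUTchI] Ex 3.2 (v) p.72) [claim: Mochizuki2012, status: disputed] -/
theorem rhoPow_pow (hC : CarrierSpec d T C) (X : T.DTheta) (n : ℕ) :
    rhoPow d T hq hC X (logqAt d T hq X ^ n) = rhoAt hC qroot X ^ n := by
  classical
  have h : logqAt d T hq X ^ n = Submonoid.pow _ n := Subtype.ext rfl
  calc rhoPow d T hq hC X (logqAt d T hq X ^ n)
      = powersHom _ (rhoAt hC qroot X) ((Submonoid.powLogEquiv (logq_pow_injective d T hq X)).symm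
          (Submonoid.pow _ n)) := by rw [← h]; rfl
    _ = rhoAt hC qroot X ^ n := by
        rw [Submonoid.powLogEquiv_symm_apply, Submonoid.log_pow_eq_self (logq_pow_injective d T hq X), powersHom_apply,
          toAdd_ofAdd]

variable (d T) in
/-- `(ℕ·log q̲_v)^gp(A^Θ) → B(Ÿ_T × A)^×`, the groupified `rhoPow`. ([IUTchI] Ex 3.2 (v) p.72) [claim: Mochizuki2012, status: disputed] -/
def rhoPowGp (hC : CarrierSpec d T C) (X : T.DTheta) :
    Algebra.GrothendieckGroup ((T.thetaDatum d hq).Φ.obj (op X) : Type) →*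
      (C.ratFnFunctor.obj (op (dThetaObj T X)) : Type)ˣ :=
  Algebra.GrothendieckGroup.lift (rhoPow d T hq hC X)

/-- `rhoPowGp` on the class of `n·log q̲_v` is `ρ^n`. ([IUTchI] Ex 3.2 (v) p.72) [claim: Mochizuki2012, status: disputed] -/
theorem rhoPowGp_of_pow (hC : CarrierSpec d T C) (X : T.DTheta) (n : ℕ) :
    rhoPowGp d T hq hC X (Algebra.GrothendieckGroup.of (logqAt d T hq X ^ n)) = rhoAt hC qroot X ^ n := by
  rw [rhoPowGp, lift_of', rhoPow_pow]

/-- `rhoPowGp` is natural in `A^Θ` (the generator is a constant section, `ρ` is natural). ([IUTchI] Ex 3.2 (v) p.72) [claim: Mochizuki2012, status: disputed] -/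
theorem rhoPowGp_natural (hC : CarrierSpec d T C) {X Y : T.DTheta} (f : X ⟶ Y)
    (γ : Algebra.GrothendieckGroup ((T.thetaDatum d hq).Φ.obj (op Y) : Type)) :
    rhoPowGp d T hq hC X (gpMap ((T.thetaDatum d hq).Φ.map f.op).hom γ) =
      Units.map (C.ratFnFunctor.map (dThetaHom T f).op).hom (rhoPowGp d T hq hC Y γ) := by
  have key : (rhoPowGp d T hq hC X).comp (gpMap ((T.thetaDatum d hq).Φ.map f.op).hom) =
      (Units.map (C.ratFnFunctor.map (dThetaHom T f).op).hom).comp (rhoPowGp d T hq hC Y) :=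
    gp_hom_ext_of' fun z => by
      obtain ⟨n, rfl⟩ := exists_eq_logqAt_pow hq Y z
      rw [MonoidHom.comp_apply, MonoidHom.comp_apply, gpMap_of, map_pow, map_logqAt, rhoPowGp_of_pow, rhoPowGp_of_pow,
        map_pow, rhoAt_natural hC hq f]
  exact DFunLike.congr_fun key γ

variable (d T) in
/-- **THE UNIT PART `B_{𝒞^Θ_v}(A^Θ) → B(Ÿ_T × A)^×`**, `x ↦ const(x) · ρ^{n(x)}` (`n(x)` = the exponent of `Div_B x` in
`(ℕ·log q̲_v)^gp`): a unit `u ∈ 𝒪^×` goes to the CONSTANT `u` («`𝒪^×(T_A) ⥲ 𝒪^×(T_{A^Θ})`»), `q̲_v` goes to `Θ̲|_{Ÿ_T × A}`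
(«`q̲_v|_{T_A} ↦ Θ̲_v|_{T_{A^Θ}}`»); a monoid homomorphism. ([IUTchI] Ex 3.2 (v) p.72) [claim: Mochizuki2012, status: disputed] -/
def unitPart (hC : CarrierSpec d T C) (X : T.DTheta) :
    ((T.thetaDatum d hq).B.obj (op X) : Type) →* (C.ratFnFunctor.obj (op (dThetaObj T X)) : Type)ˣ :=
  ((constRatFn hC (dThetaObj T X)).toHomUnits.comp ((thetaFieldUnits d T X).comp
      (((T.thetaDatum d hq).toB0.app (op X)).hom :
        ((T.thetaDatum d hq).B.obj (op X) : Type) →* (((T.thetaBase d).obj X).K)ˣ))) *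
    ((rhoPowGp d T hq hC X).comp ((T.thetaDatum d hq).divB.app (op X)).hom)

/-- The unit part, applied. ([IUTchI] Ex 3.2 (v) p.72) [claim: Mochizuki2012, status: disputed] -/
theorem unitPart_apply (hC : CarrierSpec d T C) (X : T.DTheta) (x : ((T.thetaDatum d hq).B.obj (op X) : Type)) :
    unitPart d T hq hC X x = (constRatFn hC (dThetaObj T X)).toHomUnits
        (thetaFieldUnits d T X (((T.thetaDatum d hq).toB0.app (op X)).hom x)) *
      rhoPowGp d T hq hC X (((T.thetaDatum d hq).divB.app (op X)).hom x) := rfl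

/-- **The unit part is natural in `A^Θ`**: `unitPart X ∘ B_{𝒞^Θ_v}(f) = B(Ÿ_T × f) ∘ unitPart Y` (naturality of the constants
and of `ρ^{n(·)}`). ([IUTchI] Ex 3.2 (v) p.72) [claim: Mochizuki2012, status: disputed] -/
theorem unitPart_natural (hC : CarrierSpec d T C) {X Y : T.DTheta} (f : X ⟶ Y)
    (u : ((T.thetaDatum d hq).B.obj (op Y) : Type)) :
    unitPart d T hq hC X (((T.thetaDatum d hq).B.map f.op).hom u) =
      Units.map (C.ratFnFunctor.map (dThetaHom T f).op).hom (unitPart d T hq hC Y u) := by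
  rw [unitPart_apply, unitPart_apply, map_mul]
  have hB0 : ((T.thetaDatum d hq).toB0.app (op X)).hom (((T.thetaDatum d hq).B.map f.op).hom u) =
      Units.map (((T.thetaBase d).map f).alg : ((T.thetaBase d).obj Y).K →* ((T.thetaBase d).obj X).K)
        (((T.thetaDatum d hq).toB0.app (op Y)).hom u) := by
    have h := congrArg (fun φ => CommMonCat.Hom.hom φ u) ((T.thetaDatum d hq).toB0.naturality f.op)
    simp only [CommMonCat.hom_comp, MonoidHom.comp_apply] at h
    exact h
  have hdiv : ((T.thetaDatum d hq).divB.app (op X)).hom (((T.thetaDatum d hq).B.map f.op).hom u) =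
      gpMap ((T.thetaDatum d hq).Φ.map f.op).hom (((T.thetaDatum d hq).divB.app (op Y)).hom u) := by
    have h := congrArg (fun φ => CommMonCat.Hom.hom φ u) ((T.thetaDatum d hq).divB.naturality f.op)
    simp only [CommMonCat.hom_comp, MonoidHom.comp_apply] at h
    exact h
  rw [hB0, hdiv, thetaFieldUnits_natural, rhoPowGp_natural]
  congr 1
  exact Units.ext (constRatFn_natural hC (dThetaHom T f) _)

end UnitPart

end ArithThetaTower

end Literature.AnabelianGeometry.EtaleTheta

end
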